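import Mathlib
import HarnessLib
import Summits.NavierStokesRegularity.NavierStokesRegularity.Theorems.UnthreadedDoorAntidynamoWallAccumulating

/-!
# Route `UnthreadedDoor` / `ThreadingFlux`, crux `PoloidalLiouville` (stmt-NavierStokesRegularity-1222), antidynamo v2 skeleton
# (sha16 `4ebf5683127b`), WALL `stub_scalarLiouville`: A RIGID SYMMETRY OF THE VORTICITY THAT MOVES THE CENTRE CLOSES THE WALL

Support file (seat leafhand-ns-unthreadeddoor-2 g1, cell decomp-ns), `--supports stmt-NavierStokesRegularity-1222 --as helper`; theorems only.

The symmetric sectors treated so far (p814882, p816196, p816327) are symmetries FIXING the centre `x₀`.  A rigid symmetry `g : y ↦ R y + a`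
(`R` a linear isometry) of the vorticity slice that does NOT fix the centre is much cheaper: it transports the tangency about `x₀` to tangency
about `g x₀ ≠ x₀`, i.e. it produces a SECOND CENTRE, and the accumulation closer (p816144) ends the story.  This covers helical (screw) symmetry
about any axis through `x₀` with non-zero pitch, translational periodicity, glide reflections, rotations about axes missing `x₀`, ….

* `inner_sub_movedCentre_curl_eq_zero` — tangency about `x₀` + `g`-symmetry of the slice ⇒ tangency about `g x₀ = R x₀ + a`.
* ★★ `curl_eq_zero_of_moving_symmetry_frequently` — unthreaded about `x₀` at every `t < 0` + at times accumulating at some `t₀ < 0` a rigid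
  pseudo-symmetry `curl v(t)(R y + a) = det R • R (curl v(t) y)` with `R x₀ + a ≠ x₀` (the motion may depend on the time) ⇒ `curl v ≡ 0` on
  `(−∞,0) × ℝ³`; `constant_…`; the wall's letter `stubScalarLiouville_of_moving_symmetry_frequently`.

HONEST LABEL: corollary of p816144; nothing here proves `stub_scalarLiouville`, `PoloidalLiouville` (1222), or bears on Navier–Stokes regularity;
no summit statement is proved (crux 1222 is INCOMPARABLE with the summit). [folklore]
[cite: KochNadirashviliSereginSverak2009, Thm 5.2 (arXiv:0709.3599 pp. 9–10)]
-/

noncomputable section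

-- the summit and its single sub-problem share the name (CONVENTIONS §1)
set_option linter.dupNamespace false

open scoped Topology InnerProductSpace RealInnerProductSpace ContDiff
open Filter Set Function Metric MeasureTheory
open Literature.Analysis.FluidPDE

namespace Summit.NavierStokesRegularity.NavierStokesRegularity.Theorems.PoloidalLiouville.Antidynamo

open Summit.NavierStokesRegularity.NavierStokesRegularity.Theorems.PoloidalLiouville
  (constantOfIrrotational)

/-! ### A moving symmetry transports the centre -/

/-- **A RIGID PSEUDO-SYMMETRY TRANSPORTS THE CENTRE OF TANGENCY.**  If a field `w` is tangent to the spheres about `x₀` (`⟪y − x₀, w y⟫ = 0`)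
and symmetric as a pseudovector under the rigid motion `y ↦ R y + a` (`w (R y + a) = det R • R (w y)`), then it is tangent to the spheres about
`R x₀ + a`. [folklore] -/
theorem inner_sub_movedCentre_eq_zero {w : EuclideanSpace ℝ (Fin 3) → EuclideanSpace ℝ (Fin 3)} {x₀ : EuclideanSpace ℝ (Fin 3)}
    (hun : ∀ y, ⟪y - x₀, w y⟫ = 0) (R : EuclideanSpace ℝ (Fin 3) ≃ₗᵢ[ℝ] EuclideanSpace ℝ (Fin 3)) (a : EuclideanSpace ℝ (Fin 3))
    (hsym : ∀ y, w (R y + a) = (R : EuclideanSpace ℝ (Fin 3) →L[ℝ] EuclideanSpace ℝ (Fin 3)).det • R (w y))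
    (x : EuclideanSpace ℝ (Fin 3)) : ⟪x - (R x₀ + a), w x⟫ = 0 := by
  -- write `x = R y + a`
  set y : EuclideanSpace ℝ (Fin 3) := R.symm (x - a) with hy
  have hx : x = R y + a := by rw [hy, LinearIsometryEquiv.apply_symm_apply, sub_add_cancel]
  have e1 : x - (R x₀ + a) = R (y - x₀) := by rw [hx, map_sub]; abel
  rw [e1, hx, hsym y, inner_smul_right, LinearIsometryEquiv.inner_map_map, hun y, mul_zero]

/-! ### ★★ A moving symmetry at accumulating times closes the wall -/

/-- ★★ **A RIGID SYMMETRY OF THE VORTICITY THAT MOVES THE CENTRE, AT ACCUMULATING TIMES ⇒ IRROTATIONAL.**  Let `v` be a bounded ancient mild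
solution (`ν = 1`, duality class) with measurable slices, jointly smooth on `(−∞,0) × ℝ³` and unthreaded about `x₀`.  If at times accumulating at
some `t₀ < 0` the vorticity slice is symmetric as a pseudovector under a rigid motion `y ↦ R y + a` with `R x₀ + a ≠ x₀` (the motion may depend on
the time), then `curl v ≡ 0` on `(−∞,0) × ℝ³` (second centre `R x₀ + a`; `curl_eq_zero_of_two_centres_frequently` with a moving second centre,
through the accumulation closer). [cite: KochNadirashviliSereginSverak2009, Thm 5.2 (arXiv:0709.3599 pp. 9–10)] -/
theorem curl_eq_zero_of_moving_symmetry_frequently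
    (v : ℝ → EuclideanSpace ℝ (Fin 3) → EuclideanSpace ℝ (Fin 3)) (x₀ : EuclideanSpace ℝ (Fin 3))
    (hB : Literature.Analysis.FluidPDE.IsBoundedAncientMildSolution 1 v)
    (hm : ∀ t < 0, AEStronglyMeasurable (v t) volume)
    (hsm : ContDiffOn ℝ (⊤ : ℕ∞) (Function.uncurry v) (Set.Iio 0 ×ˢ Set.univ))
    (hun : ∀ t < 0, ∀ x, ⟪x - x₀, curl (v t) x⟫ = 0)
    (hsym : ∃ t₀ < 0, ∃ᶠ t in 𝓝[≠] t₀, ∃ (R : EuclideanSpace ℝ (Fin 3) ≃ₗᵢ[ℝ] EuclideanSpace ℝ (Fin 3)) (a : EuclideanSpace ℝ (Fin 3)),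
      R x₀ + a ≠ x₀ ∧ ∀ y, curl (v t) (R y + a) =
        (R : EuclideanSpace ℝ (Fin 3) →L[ℝ] EuclideanSpace ℝ (Fin 3)).det • R (curl (v t) y)) :
    ∀ t < 0, ∀ x, curl (v t) x = 0 := by
  obtain ⟨t₀, ht₀, hfr⟩ := hsym
  have hneg0 : ∀ᶠ t in 𝓝 t₀, t < 0 := Iio_mem_nhds ht₀
  have hneg : ∀ᶠ t in 𝓝[≠] t₀, t < 0 := hneg0.filter_mono nhdsWithin_le_nhds
  refine curl_eq_zero_of_orthogonal_direction_frequently v x₀ hB hm hsm hun ⟨t₀, ht₀, ?_⟩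
  refine (hfr.and_eventually hneg).mono fun t ⟨⟨R, a, hne, hRt⟩, ht⟩ => ⟨(R x₀ + a) - x₀, sub_ne_zero.2 hne, fun x => ?_⟩
  have h0 := hun t ht x
  have h1 := inner_sub_movedCentre_eq_zero (hun t ht) R a hRt x
  have e : R x₀ + a - x₀ = (x - x₀) - (x - (R x₀ + a)) := by abel
  rw [e, inner_sub_left, h0, h1, sub_zero]

/-- ★★ **… HENCE SLICE-WISE CONSTANT.** [cite: KochNadirashviliSereginSverak2009, Thm 5.2 (arXiv:0709.3599 pp. 9–10)] -/
theorem constant_of_moving_symmetry_frequently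
    (v : ℝ → EuclideanSpace ℝ (Fin 3) → EuclideanSpace ℝ (Fin 3)) (x₀ : EuclideanSpace ℝ (Fin 3))
    (hB : Literature.Analysis.FluidPDE.IsBoundedAncientMildSolution 1 v)
    (hm : ∀ t < 0, AEStronglyMeasurable (v t) volume)
    (hsm : ContDiffOn ℝ (⊤ : ℕ∞) (Function.uncurry v) (Set.Iio 0 ×ˢ Set.univ))
    (hun : ∀ t < 0, ∀ x, ⟪x - x₀, curl (v t) x⟫ = 0)
    (hsym : ∃ t₀ < 0, ∃ᶠ t in 𝓝[≠] t₀, ∃ (R : EuclideanSpace ℝ (Fin 3) ≃ₗᵢ[ℝ] EuclideanSpace ℝ (Fin 3)) (a : EuclideanSpace ℝ (Fin 3)),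
      R x₀ + a ≠ x₀ ∧ ∀ y, curl (v t) (R y + a) =
        (R : EuclideanSpace ℝ (Fin 3) →L[ℝ] EuclideanSpace ℝ (Fin 3)).det • R (curl (v t) y)) :
    ∀ t < 0, ∃ c : EuclideanSpace ℝ (Fin 3), ∀ x, v t x = c :=
  constantOfIrrotational v hB hsm (curl_eq_zero_of_moving_symmetry_frequently v x₀ hB hm hsm hun hsym)

/-- ★★ **THE WALL'S LETTER: A MOVING RIGID SYMMETRY OF `∇T × (x − x₀)` AT ACCUMULATING TIMES ⇒ TRIVIAL.**
[cite: KochNadirashviliSereginSverak2009, Thm 5.2 (arXiv:0709.3599 pp. 9–10)] -/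
theorem stubScalarLiouville_of_moving_symmetry_frequently
    (v : ℝ → EuclideanSpace ℝ (Fin 3) → EuclideanSpace ℝ (Fin 3)) (x₀ : EuclideanSpace ℝ (Fin 3))
    (T : ℝ → EuclideanSpace ℝ (Fin 3) → ℝ)
    (hB : Literature.Analysis.FluidPDE.IsBoundedAncientMildSolution 1 v)
    (hm : ∀ t < 0, AEStronglyMeasurable (v t) volume)
    (hsm : ContDiffOn ℝ (⊤ : ℕ∞) (Function.uncurry v) (Set.Iio 0 ×ˢ Set.univ))
    (hrep : ∀ t < 0, ∀ x, Literature.Analysis.FluidPDE.curl (v t) x =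
      Literature.Analysis.FluidPDE.cross (gradient (T t) x) (x - x₀))
    (hsym : ∃ t₀ < 0, ∃ᶠ t in 𝓝[≠] t₀, ∃ (R : EuclideanSpace ℝ (Fin 3) ≃ₗᵢ[ℝ] EuclideanSpace ℝ (Fin 3)) (a : EuclideanSpace ℝ (Fin 3)),
      R x₀ + a ≠ x₀ ∧ ∀ y, Literature.Analysis.FluidPDE.cross (gradient (T t) (R y + a)) (R y + a - x₀) =
        (R : EuclideanSpace ℝ (Fin 3) →L[ℝ] EuclideanSpace ℝ (Fin 3)).det •
          R (Literature.Analysis.FluidPDE.cross (gradient (T t) y) (y - x₀))) :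
    ∀ t < 0, ∀ x, Literature.Analysis.FluidPDE.cross (gradient (T t) x) (x - x₀) = 0 := by
  have hun : ∀ t < 0, ∀ x, ⟪x - x₀, curl (v t) x⟫ = 0 := fun t ht x => by
    rw [hrep t ht x]
    simp [cross, crossProduct, PiLp.inner_apply, Fin.sum_univ_three]
    ring
  obtain ⟨t₀, ht₀, hfr⟩ := hsym
  have hneg0 : ∀ᶠ t in 𝓝 t₀, t < 0 := Iio_mem_nhds ht₀
  have hneg : ∀ᶠ t in 𝓝[≠] t₀, t < 0 := hneg0.filter_mono nhdsWithin_le_nhds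
  have hfr' : ∃ᶠ t in 𝓝[≠] t₀, ∃ (R : EuclideanSpace ℝ (Fin 3) ≃ₗᵢ[ℝ] EuclideanSpace ℝ (Fin 3)) (a : EuclideanSpace ℝ (Fin 3)),
      R x₀ + a ≠ x₀ ∧ ∀ y, curl (v t) (R y + a) =
        (R : EuclideanSpace ℝ (Fin 3) →L[ℝ] EuclideanSpace ℝ (Fin 3)).det • R (curl (v t) y) :=
    (hfr.and_eventually hneg).mono fun t ⟨⟨R, a, hne, hRt⟩, ht⟩ =>
      ⟨R, a, hne, fun y => by rw [hrep t ht, hrep t ht]; exact hRt y⟩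
  intro t ht x
  rw [← hrep t ht x]
  exact curl_eq_zero_of_moving_symmetry_frequently v x₀ hB hm hsm hun ⟨t₀, ht₀, hfr'⟩ t ht x

end Summit.NavierStokesRegularity.NavierStokesRegularity.Theorems.PoloidalLiouville.Antidynamo

end
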